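import Summits.Ventures.PercRepro.Night2FatXDistTwo

/-!
# night-2: the dichotomy of the loads at a target containing both off-points

**`loaded_fat_target_dichotomy`**: in the fat case `G ∖ clF B₀ = {w₀, x}`, a loaded target `T ⊆ G` carries a
rank-`2` line `R ⊆ (T ∖ K) ∖ {w₀, x}` with `|R| ≥ 3` (the line of its source, which misses both off-points), and
either `|R| + 4 = |T ∖ K|` with `rk (G ∖ T) ≥ 3` — a distance-1 load, whose source `T ∖ {w₀}` or `T ∖ {x}` has a
complement of rank `≥ 4` — or `|R| + 5 = |T ∖ K|` with `rk (R ∪ {w₀, x}) ≤ 3` — a distance-2 load of a pair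
without good points (`rkN_line_off_le_three_of_no_gtPts`).  Above a basis pair `(B, z)` with `w₀ ∈ Q`, `x ∉ Q`
this says: a loaded `T = Q ∪ {x} ∪ Y` at level `j = |Y| + 1` has `Y ∪ {a, b}` collinear for two basis points
`a, b` and `rk (G ∖ T) ≥ 3` (distance one), or a line `R` of `j` points of `(Q ∖ {w₀}) ∪ Y` coplanar with
`w₀, x` (distance two).  Paper `proofs/NIGHT-2-g33.md` §4.
-/

namespace PercRepro.Shadow

open PercRepro.ThmH PercRepro.PerFlat

variable {α : Type*} [DecidableEq α] {M : Matroid α} [M.Finite] {G : Finset α}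

/-- **The two kinds of loads at a target containing both off-points**: a loaded `T ⊆ G` carries a rank-`2` line
`R ⊆ (T ∖ K) ∖ {w₀, x}` with `|R| ≥ 3`, and either `|R| + 4 = |T ∖ K|` with `rk (G ∖ T) ≥ 3` (a distance-1 load)
or `|R| + 5 = |T ∖ K|` with `rk (R ∪ {w₀, x}) ≤ 3` (a distance-2 load of a pair without good points). -/
theorem loaded_fat_target_dichotomy (hG : G ∈ flatsQ M (5 + 1)) (hd : (gr M \ G).card = 2)
    (hk : kColoops M G = 1) (hs : ∀ e ∈ gr M, ∀ f ∈ gr M, e ≠ f → rkN M {e, f} = 2)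
    (hl : ∀ e ∈ gr M, M.Indep {e}) (hfat : (fatClosures M 5 G 2).card ≤ 1) {B₀ : Finset α}
    (hB₀ : B₀ ∈ thinMembers M 5 G) {w₀ x : α} (hD : G \ clF M B₀ = {w₀, x}) {T : Finset α} (hTG : T ⊆ G)
    (hload : dload M 5 G (bigP M G) (dshGT2 M 5 G) T ≠ 0) :
    ∃ R ⊆ (T \ coloops M G) \ {w₀, x}, rkN M R = 2 ∧ 3 ≤ R.card ∧
      ((R.card + 4 = (T \ coloops M G).card ∧ 3 ≤ rkN M (G \ T)) ∨
        (R.card + 5 = (T \ coloops M G).card ∧ rkN M (insert w₀ (insert x R)) ≤ 3)) := by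
  obtain ⟨B, hB, hbig, z, hz, hloss, hcase⟩ := exists_pair_of_dload_ne_zero' hG hd hk hs hl hfat hload
  obtain ⟨hR2, hRcard⟩ := rkN_sdiff_coloops_eq_two_of_loss_ne_zero hG hd hk hs hl hB hbig hz hloss
  have hcop : ¬ (gtPts M 5 G (insert z B)).Nonempty → rkN M (insert w₀ (insert x
      ((insert z B \ coloops M G) \ coloops M (insert z B \ coloops M G)))) ≤ 3 :=
    fun hno => rkN_line_off_le_three_of_no_gtPts hG hd hk hs hl hB₀ hD hB hbig hz hloss hno
  obtain ⟨R, hRdef⟩ : ∃ R : Finset α,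
      R = (insert z B \ coloops M G) \ coloops M (insert z B \ coloops M G) := ⟨_, rfl⟩
  rw [← hRdef] at hR2 hRcard hcop
  have hGg : G ⊆ gr M := (mem_flatsQ.1 hG).1
  have hd' : (gr M \ G).card ≤ 5 := by omega
  have hQG : insert z B ⊆ G :=
    Finset.insert_subset (Finset.mem_sdiff.1 hz).1 (subset_G_of_mem_thinMembers hB)
  have hKB : coloops M G ⊆ B := coloops_subset_of_mem_thinMembers hG hd' hB
  have hKQ : coloops M G ⊆ insert z B := hKB.trans (Finset.subset_insert _ _)
  have hzB : z ∉ B := fun h' => (Finset.mem_sdiff.1 hz).2 (subset_clF_of_subset_gr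
    ((subset_G_of_mem_thinMembers hB).trans hGg) h')
  have hzK : z ∉ coloops M G := fun h' => hzB (hKB h')
  have hQ'6 : 6 ≤ (insert z B \ coloops M G).card := by
    have heq : insert z B \ coloops M G = insert z (B \ coloops M G) := by
      ext e
      simp only [Finset.mem_sdiff, Finset.mem_insert]
      constructor
      · rintro ⟨h' | h', h2⟩
        · exact Or.inl h'
        · exact Or.inr ⟨h', h2⟩
      · rintro (rfl | ⟨h', h2⟩)
        · exact ⟨Or.inl rfl, hzK⟩
        · exact ⟨Or.inr h', h2⟩
    rw [heq, Finset.card_insert_of_notMem (fun h' => hzB (Finset.mem_sdiff.1 h').1)]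
    omega
  have hR3 : 3 ≤ R.card := by omega
  have hRQ' : R ⊆ insert z B \ coloops M G := by
    rw [hRdef]
    exact Finset.sdiff_subset
  have hRG : R ⊆ G := hRQ'.trans (Finset.sdiff_subset.trans hQG)
  have hoff := notMem_or_notMem_insert_of_loss_ne_zero hG hd hk hs hl hB₀ hD hB hbig hz hloss
  have hRoff : ∀ u v : α, ({w₀, x} : Finset α) = {u, v} → u ∉ insert z B → u ∉ R ∧ v ∉ R := by
    intro u v huv huQ
    have huR : u ∉ R := fun h' => huQ (Finset.mem_sdiff.1 (hRQ' h')).1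
    exact ⟨huR, notMem_of_rkN_le_two_of_notMem hs hG hD hRG (by omega) hR3
      (by rw [huv]; exact Finset.pair_comm _ _) huR⟩
  have hw₀x : w₀ ∉ R ∧ x ∉ R := by
    rcases hoff with h' | h'
    · exact hRoff w₀ x rfl h'
    · exact (hRoff x w₀ (Finset.pair_comm _ _) h').symm
  have h4 := four_le_rkN_sdiff_insert_of_loss_ne_zero hG hd hk hs hl hB hbig hz hloss
  rcases hcase with ⟨-, x', hx', rfl⟩ | ⟨hno, p, hp, rfl⟩
  · obtain ⟨hx'G, hx'Q⟩ := Finset.mem_sdiff.1 (mem_goodPts.1 hx').1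
    have hx'K : x' ∉ coloops M G := fun h' => hx'Q (hKQ h')
    refine ⟨R, ?_, hR2, hR3, Or.inl ⟨?_, ?_⟩⟩
    · intro r hr
      rw [Finset.mem_sdiff, Finset.mem_insert, Finset.mem_singleton]
      refine ⟨Finset.sdiff_subset_sdiff (Finset.subset_insert _ _) (Finset.Subset.refl _) (hRQ' hr), ?_⟩
      rintro (rfl | rfl)
      · exact hw₀x.1 hr
      · exact hw₀x.2 hr
    · have heq : insert x' (insert z B) \ coloops M G = insert x' (insert z B \ coloops M G) := by
        ext e
        simp only [Finset.mem_sdiff, Finset.mem_insert]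
        constructor
        · rintro ⟨h' | h', h2⟩
          · exact Or.inl h'
          · exact Or.inr ⟨h', h2⟩
        · rintro (rfl | ⟨h', h2⟩)
          · exact ⟨Or.inl rfl, hx'K⟩
          · exact ⟨Or.inr h', h2⟩
      rw [heq, Finset.card_insert_of_notMem (fun h' => hx'Q (Finset.mem_sdiff.1 h').1)]
      omega
    · have heq : G \ insert z B = insert x' (G \ insert x' (insert z B)) := by
        ext e
        simp only [Finset.mem_sdiff, Finset.mem_insert, not_or]
        constructor
        · rintro ⟨heG, heQ⟩
          by_cases hex : e = x'
          · exact Or.inl hex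
          · exact Or.inr ⟨heG, hex, heQ⟩
        · rintro (rfl | ⟨heG, -, heQ⟩)
          · refine ⟨hx'G, ?_⟩
            rwa [Finset.mem_insert, not_or] at hx'Q
          · exact ⟨heG, heQ⟩
      rw [heq] at h4
      have := rkN_insert_le_succ (M := M) (G \ insert x' (insert z B)) x'
      omega
  · obtain ⟨⟨hp1, hp2⟩, hp12, -⟩ := mem_d2Pts.1 hp
    have hp1Q : p.1 ∉ insert z B := (Finset.mem_sdiff.1 hp1).2
    have hp2Q : p.2 ∉ insert z B := (Finset.mem_sdiff.1 hp2).2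
    have hp1K : p.1 ∉ coloops M G := fun h' => hp1Q (hKQ h')
    have hp2K : p.2 ∉ coloops M G := fun h' => hp2Q (hKQ h')
    refine ⟨R, ?_, hR2, hR3, Or.inr ⟨?_, hcop hno⟩⟩
    · intro r hr
      rw [Finset.mem_sdiff, Finset.mem_insert, Finset.mem_singleton]
      refine ⟨Finset.sdiff_subset_sdiff ((Finset.subset_insert _ _).trans (Finset.subset_insert _ _))
        (Finset.Subset.refl _) (hRQ' hr), ?_⟩
      rintro (rfl | rfl)
      · exact hw₀x.1 hr
      · exact hw₀x.2 hr
    · have heq : insert p.1 (insert p.2 (insert z B)) \ coloops M G =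
          insert p.1 (insert p.2 (insert z B \ coloops M G)) := by
        ext e
        simp only [Finset.mem_sdiff, Finset.mem_insert]
        constructor
        · rintro ⟨h' | h' | h', h2⟩
          · exact Or.inl h'
          · exact Or.inr (Or.inl h')
          · exact Or.inr (Or.inr ⟨h', h2⟩)
        · rintro (rfl | rfl | ⟨h', h2⟩)
          · exact ⟨Or.inl rfl, hp1K⟩
          · exact ⟨Or.inr (Or.inl rfl), hp2K⟩
          · exact ⟨Or.inr (Or.inr h'), h2⟩
      rw [heq, Finset.card_insert_of_notMem, Finset.card_insert_of_notMem
        (fun h' => hp2Q (Finset.mem_sdiff.1 h').1)]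
      · omega
      · rw [Finset.mem_insert, Finset.mem_sdiff]
        rintro (h' | ⟨h', -⟩)
        · exact hp12 h'
        · exact hp1Q h'

end PercRepro.Shadow
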